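import Mathlib
import HarnessLib
import Summits.HubbardSuperconductivity.HubbardSuperconductivity.Theorems.KLProgrammePerturbedFermiCurveCompChain

/-!
# Route `KLProgramme` — the FULLY structured chain-rule bounds to order four: separate curve sizes `D₁ … D₄`
# (`|∂⁴(F∘γ)| ≤ M₄D₁⁴ + 6M₃D₁²D₂ + 3M₂D₂² + 4M₂D₁D₃ + M₁D₄`, etc.)

Cell `gate-hubbard-kl`, seat hubbard-kl-k3c3-p3 (g3; row «implicit-function / monotonicity route»).  Companion of
`…PerturbedFermiCurveCompChain` (p483894), whose §3 collapses the curve sizes to powers `Dⁱ` of one graded constant.  For the ENGINE child's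
two-leg stubs (stmt-HubbardSuperconductivity-19855) the MULTI-SLOT size clause (E3a-MS) (`TwoLegSizesMS`, gen 5: `TwoLegSizesMSFn`) needs the
order-3/4 sizes of the scale-`n` INCREMENT `δν_n = ν_n − ν_{n−1} = evalM (symInterp L Δσ_n) ∘ γ_K` with their dependence on the frame's
order-3/4 sizes kept LINEAR: the curve `γ_K = toLp ∘ k_F^K` of an admissible frame has `‖γ′‖, ‖γ″‖ = O(1)` but `‖γ‴‖ = O(1 + A₃)`,
`‖γ⁗‖ = O(1 + A₃ + A₄)` (`A_j = ‖Dʲ frameShift K‖ = Σ_m Gfr_j·U²·4^{(j−2)m}`, k3c3-p3 g2 `abs_deriv_three/four_frameRadius_le`), so a single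
`D ≍ 2^{N+1}` would charge the order-1 increment `m₁(Δσ_n) ≍ U²4^{−n}` with `2^{N+1}` and destroy the scale-`n` grading, whereas the true
order-3 term is `m₁·D₃ = m₁·(a₃ + b₃A₃)` — the (M5)/(E3a-MS) structure «top moment linear in the deeper slots' frame allowance»
(HOME/prover-p1b/g6/TWO-LEG-CLOSERS.md §2).  This module states the bounds with SEPARATE `D₁, D₂, D₃, D₄`:

* `abs_iteratedDeriv_{one,two,three,four}_comp_le_struct`: with `‖DᵏF(γ θ)‖ ≤ M_k` and `‖γ^{(i)}(θ)‖ ≤ D_i`: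
  `|∂¹| ≤ M₁D₁`, `|∂²| ≤ M₂D₁² + M₁D₂`, `|∂³| ≤ M₃D₁³ + 3M₂D₁D₂ + M₁D₃`, `|∂⁴| ≤ M₄D₁⁴ + 6M₃D₁²D₂ + 3M₂D₂² + 4M₂D₁D₃ + M₁D₄`
  (Faà di Bruno with Bell-polynomial coefficients); packaged `abs_iteratedDeriv_comp_le_bell`.

Everything is PROVED; carrier-free (any real normed space); nothing about the Hubbard model.  References: Faà di Bruno [folklore];
BGM 2006 §2.4 (2.36)/(2.40) [cite: BenfattoGiulianiMastropietro2006].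
-/

noncomputable section

namespace Summit.HubbardSuperconductivity.HubbardSuperconductivity.Theorems.PerturbedFermiCurve

set_option linter.dupNamespace false -- summit = problem name (single-conjunct summit), D-0017
set_option maxSynthPendingDepth 3 -- nested operator-norm instances `V →L V →L V →L ℝ` (third/fourth Fréchet derivatives)

open Real Set Finset

section Bounds

variable {V : Type*} [NormedAddCommGroup V] [NormedSpace ℝ V] {F : V → ℝ} {γ : ℝ → V}
  (hF : ContDiff ℝ 4 F) (hγ : ContDiff ℝ 4 γ) {θ M₁ M₂ M₃ M₄ D₁ D₂ D₃ D₄ : ℝ}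
  (hM₁ : ‖iteratedFDeriv ℝ 1 F (γ θ)‖ ≤ M₁) (hM₂ : ‖iteratedFDeriv ℝ 2 F (γ θ)‖ ≤ M₂)
  (hM₃ : ‖iteratedFDeriv ℝ 3 F (γ θ)‖ ≤ M₃) (hM₄ : ‖iteratedFDeriv ℝ 4 F (γ θ)‖ ≤ M₄)
  (hD₁ : ‖iteratedDeriv 1 γ θ‖ ≤ D₁) (hD₂ : ‖iteratedDeriv 2 γ θ‖ ≤ D₂) (hD₃ : ‖iteratedDeriv 3 γ θ‖ ≤ D₃)
  (hD₄ : ‖iteratedDeriv 4 γ θ‖ ≤ D₄)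
include hF hγ

section One
include hM₁ hD₁

/-- **Order 1**: `|∂(F∘γ)(θ)| ≤ M₁·D₁`. [folklore] -/
theorem abs_iteratedDeriv_one_comp_le_struct : |iteratedDeriv 1 (F ∘ γ) θ| ≤ M₁ * D₁ :=
  abs_iteratedDeriv_one_comp_le hF hγ hM₁ hD₁

end One

section Two
include hM₁ hM₂ hD₁ hD₂

/-- **Order 2**: `|∂²(F∘γ)(θ)| ≤ M₂·D₁² + M₁·D₂`. [folklore] -/
theorem abs_iteratedDeriv_two_comp_le_struct : |iteratedDeriv 2 (F ∘ γ) θ| ≤ M₂ * D₁ ^ 2 + M₁ * D₂ := by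
  rw [iteratedDeriv_two_comp_eq hF hγ θ]
  have hE₁ : ‖fderiv ℝ F (γ θ)‖ ≤ M₁ := by rw [norm_fderiv_eq_norm_iteratedFDeriv_one]; exact hM₁
  have hE₂ : ‖fderiv ℝ (fderiv ℝ F) (γ θ)‖ ≤ M₂ := by rw [norm_fderiv_two_eq_norm_iteratedFDeriv]; exact hM₂
  have hM10 : 0 ≤ M₁ := (norm_nonneg _).trans hE₁; have hM20 : 0 ≤ M₂ := (norm_nonneg _).trans hE₂
  have hD0 : 0 ≤ D₁ := (norm_nonneg _).trans hD₁
  set v₁ := iteratedDeriv 1 γ θ; set v₂ := iteratedDeriv 2 γ θ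
  have h2 : |fderiv ℝ (fderiv ℝ F) (γ θ) v₁ v₁| ≤ M₂ * D₁ ^ 2 := by
    calc _ ≤ M₂ * ‖v₁‖ * ‖v₁‖ := abs_apply₂_le_of_opNorm_le _ hE₂ _ _
      _ ≤ M₂ * D₁ * D₁ := by gcongr
      _ = M₂ * D₁ ^ 2 := by ring
  have h1 : |fderiv ℝ F (γ θ) v₂| ≤ M₁ * D₂ := (abs_apply_le_of_opNorm_le _ hE₁ _).trans (by gcongr)
  exact abs_add_le_add h2 h1

end Two

section Three
include hM₁ hM₂ hM₃ hD₁ hD₂ hD₃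

/-- **Order 3**: `|∂³(F∘γ)(θ)| ≤ M₃·D₁³ + 3·M₂·D₁·D₂ + M₁·D₃`. [folklore] -/
theorem abs_iteratedDeriv_three_comp_le_struct :
    |iteratedDeriv 3 (F ∘ γ) θ| ≤ M₃ * D₁ ^ 3 + 3 * M₂ * D₁ * D₂ + M₁ * D₃ := by
  rw [iteratedDeriv_three_comp_eq hF hγ θ]
  have hE₁ : ‖fderiv ℝ F (γ θ)‖ ≤ M₁ := by rw [norm_fderiv_eq_norm_iteratedFDeriv_one]; exact hM₁
  have hE₂ : ‖fderiv ℝ (fderiv ℝ F) (γ θ)‖ ≤ M₂ := by rw [norm_fderiv_two_eq_norm_iteratedFDeriv]; exact hM₂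
  have hE₃ : ‖fderiv ℝ (fderiv ℝ (fderiv ℝ F)) (γ θ)‖ ≤ M₃ := by rw [norm_fderiv_three_eq_norm_iteratedFDeriv]; exact hM₃
  have hM10 : 0 ≤ M₁ := (norm_nonneg _).trans hE₁; have hM20 : 0 ≤ M₂ := (norm_nonneg _).trans hE₂
  have hM30 : 0 ≤ M₃ := (norm_nonneg _).trans hE₃
  have hD10 : 0 ≤ D₁ := (norm_nonneg _).trans hD₁; have hD20 : 0 ≤ D₂ := (norm_nonneg _).trans hD₂
  set v₁ := iteratedDeriv 1 γ θ; set v₂ := iteratedDeriv 2 γ θ; set v₃ := iteratedDeriv 3 γ θ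
  have h3 : |fderiv ℝ (fderiv ℝ (fderiv ℝ F)) (γ θ) v₁ v₁ v₁| ≤ M₃ * D₁ ^ 3 := by
    calc _ ≤ M₃ * ‖v₁‖ * ‖v₁‖ * ‖v₁‖ := abs_apply₃_le_of_opNorm_le _ hE₃ _ _ _
      _ ≤ M₃ * D₁ * D₁ * D₁ := by gcongr
      _ = M₃ * D₁ ^ 3 := by ring
  have h21 : |fderiv ℝ (fderiv ℝ F) (γ θ) v₂ v₁| ≤ M₂ * D₂ * D₁ := by
    calc _ ≤ M₂ * ‖v₂‖ * ‖v₁‖ := abs_apply₂_le_of_opNorm_le _ hE₂ _ _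
      _ ≤ M₂ * D₂ * D₁ := by gcongr
  have h12 : |fderiv ℝ (fderiv ℝ F) (γ θ) v₁ v₂| ≤ M₂ * D₁ * D₂ := by
    calc _ ≤ M₂ * ‖v₁‖ * ‖v₂‖ := abs_apply₂_le_of_opNorm_le _ hE₂ _ _
      _ ≤ M₂ * D₁ * D₂ := by gcongr
  have h1 : |fderiv ℝ F (γ θ) v₃| ≤ M₁ * D₃ := (abs_apply_le_of_opNorm_le _ hE₁ _).trans (by gcongr)
  calc _ ≤ M₃ * D₁ ^ 3 + M₂ * D₂ * D₁ + M₂ * D₁ * D₂ + (M₂ * D₁ * D₂ + M₁ * D₃) :=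
        abs_add_le_add (abs_add_le_add (abs_add_le_add h3 h21) h12) (abs_add_le_add h12 h1)
    _ = M₃ * D₁ ^ 3 + 3 * M₂ * D₁ * D₂ + M₁ * D₃ := by ring

end Three

section Four
include hM₁ hM₂ hM₃ hM₄ hD₁ hD₂ hD₃ hD₄

/-- **Order 4**: `|∂⁴(F∘γ)(θ)| ≤ M₄·D₁⁴ + 6·M₃·D₁²·D₂ + 3·M₂·D₂² + 4·M₂·D₁·D₃ + M₁·D₄`. [folklore] -/
theorem abs_iteratedDeriv_four_comp_le_struct :
    |iteratedDeriv 4 (F ∘ γ) θ| ≤ M₄ * D₁ ^ 4 + 6 * M₃ * D₁ ^ 2 * D₂ + 3 * M₂ * D₂ ^ 2 + 4 * M₂ * D₁ * D₃ + M₁ * D₄ := by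
  rw [iteratedDeriv_four_comp_eq hF hγ θ]
  have hE₁ : ‖fderiv ℝ F (γ θ)‖ ≤ M₁ := by rw [norm_fderiv_eq_norm_iteratedFDeriv_one]; exact hM₁
  have hE₂ : ‖fderiv ℝ (fderiv ℝ F) (γ θ)‖ ≤ M₂ := by rw [norm_fderiv_two_eq_norm_iteratedFDeriv]; exact hM₂
  have hE₃ : ‖fderiv ℝ (fderiv ℝ (fderiv ℝ F)) (γ θ)‖ ≤ M₃ := by rw [norm_fderiv_three_eq_norm_iteratedFDeriv]; exact hM₃
  have hE₄ : ‖fderiv ℝ (fderiv ℝ (fderiv ℝ (fderiv ℝ F))) (γ θ)‖ ≤ M₄ := by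
    rw [norm_fderiv_four_eq_norm_iteratedFDeriv]; exact hM₄
  have hM10 : 0 ≤ M₁ := (norm_nonneg _).trans hE₁; have hM20 : 0 ≤ M₂ := (norm_nonneg _).trans hE₂
  have hM30 : 0 ≤ M₃ := (norm_nonneg _).trans hE₃; have hM40 : 0 ≤ M₄ := (norm_nonneg _).trans hM₄
  have hD10 : 0 ≤ D₁ := (norm_nonneg _).trans hD₁; have hD20 : 0 ≤ D₂ := (norm_nonneg _).trans hD₂
  have hD30 : 0 ≤ D₃ := (norm_nonneg _).trans hD₃
  set v₁ := iteratedDeriv 1 γ θ; set v₂ := iteratedDeriv 2 γ θ; set v₃ := iteratedDeriv 3 γ θ; set v₄ := iteratedDeriv 4 γ θ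
  have h4 : |fderiv ℝ (fderiv ℝ (fderiv ℝ (fderiv ℝ F))) (γ θ) v₁ v₁ v₁ v₁| ≤ M₄ * D₁ ^ 4 := by
    calc _ ≤ M₄ * ‖v₁‖ * ‖v₁‖ * ‖v₁‖ * ‖v₁‖ := abs_apply₄_le_of_opNorm_le _ hE₄ _ _ _ _
      _ ≤ M₄ * D₁ * D₁ * D₁ * D₁ := by gcongr
      _ = M₄ * D₁ ^ 4 := by ring
  have h211 : |fderiv ℝ (fderiv ℝ (fderiv ℝ F)) (γ θ) v₂ v₁ v₁| ≤ M₃ * D₁ ^ 2 * D₂ := by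
    calc _ ≤ M₃ * ‖v₂‖ * ‖v₁‖ * ‖v₁‖ := abs_apply₃_le_of_opNorm_le _ hE₃ _ _ _
      _ ≤ M₃ * D₂ * D₁ * D₁ := by gcongr
      _ = M₃ * D₁ ^ 2 * D₂ := by ring
  have h121 : |fderiv ℝ (fderiv ℝ (fderiv ℝ F)) (γ θ) v₁ v₂ v₁| ≤ M₃ * D₁ ^ 2 * D₂ := by
    calc _ ≤ M₃ * ‖v₁‖ * ‖v₂‖ * ‖v₁‖ := abs_apply₃_le_of_opNorm_le _ hE₃ _ _ _
      _ ≤ M₃ * D₁ * D₂ * D₁ := by gcongr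
      _ = M₃ * D₁ ^ 2 * D₂ := by ring
  have h112 : |fderiv ℝ (fderiv ℝ (fderiv ℝ F)) (γ θ) v₁ v₁ v₂| ≤ M₃ * D₁ ^ 2 * D₂ := by
    calc _ ≤ M₃ * ‖v₁‖ * ‖v₁‖ * ‖v₂‖ := abs_apply₃_le_of_opNorm_le _ hE₃ _ _ _
      _ ≤ M₃ * D₁ * D₁ * D₂ := by gcongr
      _ = M₃ * D₁ ^ 2 * D₂ := by ring
  have h31 : |fderiv ℝ (fderiv ℝ F) (γ θ) v₃ v₁| ≤ M₂ * D₁ * D₃ := by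
    calc _ ≤ M₂ * ‖v₃‖ * ‖v₁‖ := abs_apply₂_le_of_opNorm_le _ hE₂ _ _
      _ ≤ M₂ * D₃ * D₁ := by gcongr
      _ = M₂ * D₁ * D₃ := by ring
  have h13 : |fderiv ℝ (fderiv ℝ F) (γ θ) v₁ v₃| ≤ M₂ * D₁ * D₃ := by
    calc _ ≤ M₂ * ‖v₁‖ * ‖v₃‖ := abs_apply₂_le_of_opNorm_le _ hE₂ _ _
      _ ≤ M₂ * D₁ * D₃ := by gcongr
  have h22 : |fderiv ℝ (fderiv ℝ F) (γ θ) v₂ v₂| ≤ M₂ * D₂ ^ 2 := by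
    calc _ ≤ M₂ * ‖v₂‖ * ‖v₂‖ := abs_apply₂_le_of_opNorm_le _ hE₂ _ _
      _ ≤ M₂ * D₂ * D₂ := by gcongr
      _ = M₂ * D₂ ^ 2 := by ring
  have h1 : |fderiv ℝ F (γ θ) v₄| ≤ M₁ * D₄ := (abs_apply_le_of_opNorm_le _ hE₁ _).trans (by gcongr)
  have hM := abs_add_le_add (abs_add_le_add (abs_add_le_add (abs_add_le_add
    (abs_add_le_add (abs_add_le_add (abs_add_le_add h4 h211) h121) h112)
    (abs_add_le_add (abs_add_le_add h121 h31) h22))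
    (abs_add_le_add (abs_add_le_add h112 h22) h13))
    (abs_add_le_add (abs_add_le_add h112 h22) h13)) (abs_add_le_add h13 h1)
  refine hM.trans (le_of_eq ?_)
  ring

end Four

end Bounds

/-! ## Packaged form -/

section Packaged

variable {V : Type*} [NormedAddCommGroup V] [NormedSpace ℝ V] {F : V → ℝ} {γ : ℝ → V}

/-- **The fully structured chain-rule bound (Bell polynomials), orders `1 … 4`.**  With `‖DᵏF(γ θ)‖ ≤ M k` (`1 ≤ k ≤ 4`) and
`‖γ^{(i)}(θ)‖ ≤ D i` (`1 ≤ i ≤ 4`): `|∂¹| ≤ M 1·D 1`, `|∂²| ≤ M 2·(D 1)² + M 1·D 2`, `|∂³| ≤ M 3·(D 1)³ + 3·M 2·D 1·D 2 + M 1·D 3`,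
`|∂⁴| ≤ M 4·(D 1)⁴ + 6·M 3·(D 1)²·D 2 + 3·M 2·(D 2)² + 4·M 2·D 1·D 3 + M 1·D 4`. [folklore] -/
theorem abs_iteratedDeriv_comp_le_bell (hF : ContDiff ℝ 4 F) (hγ : ContDiff ℝ 4 γ) {θ : ℝ} {M D : ℕ → ℝ}
    (hM : ∀ k, 1 ≤ k → k ≤ 4 → ‖iteratedFDeriv ℝ k F (γ θ)‖ ≤ M k)
    (hD : ∀ i, 1 ≤ i → i ≤ 4 → ‖iteratedDeriv i γ θ‖ ≤ D i) :
    |iteratedDeriv 1 (F ∘ γ) θ| ≤ M 1 * D 1 ∧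
      |iteratedDeriv 2 (F ∘ γ) θ| ≤ M 2 * D 1 ^ 2 + M 1 * D 2 ∧
      |iteratedDeriv 3 (F ∘ γ) θ| ≤ M 3 * D 1 ^ 3 + 3 * M 2 * D 1 * D 2 + M 1 * D 3 ∧
      |iteratedDeriv 4 (F ∘ γ) θ| ≤ M 4 * D 1 ^ 4 + 6 * M 3 * D 1 ^ 2 * D 2 + 3 * M 2 * D 2 ^ 2 + 4 * M 2 * D 1 * D 3 + M 1 * D 4 := by
  have hD₁ := hD 1 le_rfl (by norm_num); have hD₂ := hD 2 (by norm_num) (by norm_num)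
  have hD₃ := hD 3 (by norm_num) (by norm_num); have hD₄ := hD 4 (by norm_num) le_rfl
  have hM₁ := hM 1 le_rfl (by norm_num); have hM₂ := hM 2 (by norm_num) (by norm_num)
  have hM₃ := hM 3 (by norm_num) (by norm_num); have hM₄ := hM 4 (by norm_num) le_rfl
  exact ⟨abs_iteratedDeriv_one_comp_le_struct hF hγ hM₁ hD₁, abs_iteratedDeriv_two_comp_le_struct hF hγ hM₁ hM₂ hD₁ hD₂,
    abs_iteratedDeriv_three_comp_le_struct hF hγ hM₁ hM₂ hM₃ hD₁ hD₂ hD₃,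
    abs_iteratedDeriv_four_comp_le_struct hF hγ hM₁ hM₂ hM₃ hM₄ hD₁ hD₂ hD₃ hD₄⟩

end Packaged

end Summit.HubbardSuperconductivity.HubbardSuperconductivity.Theorems.PerturbedFermiCurve

end
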